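import Mathlib
import Summits.Ventures.PercRepro2.TypedMarkedSeriesDefs
import Summits.Ventures.PercRepro2.TypedMarkedSeriesGraph

/-!
# Marked series vertices of degree two: the state lemma of rule G — `o` between `a₃` and `b`
(blind cell PercRepro2, night-3 g14, 2026-08-27; `proofs/NIGHT3-CERT.md` §23.8)

`st_modelG`: when `o` carries exactly the edges `e = {a₃, o}` (bit `p`) and `f = {o, b}` (bit `a`),
the state of `x[e ↦ p][f ↦ a]` is an explicit Boolean function («model G», written out in place) of
the signature `(c12, c1b, c13, c2b, c23, cb3)` of `x[e ↦ closed][f ↦ closed]` — the seven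
coordinates by `conn_off_mid` (connections off `o`: the merged edge `a₃ – b` is open iff `p && a`)
and `conn_mid_iff` (`o` itself: `o ~ s` iff `p` and `a₃ ~ s`, or `a` and `b ~ s`, in the opened
configuration).  Nothing here asserts anything about the original lane.
-/

namespace Summit.Ventures.PercRepro2

open UnionCluster

namespace CovForm

namespace MarkedSeries

open OneTyped TypedA3 Untouched TypedRed

section StateLemmas

open Classical

variable {V : Type*} {E : Type*} [DecidableEq E]
variable (ends : E → Sym2 V) (o a₁ a₂ a₃ b : V)

/-- **State lemma G**: `o` with exactly the edges `e = {a₃, o}` and `f = {o, b}`; with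
`Lb := c1b || (p && a && c13)`, `Hb := c2b || (p && a && c23)`, `L3 := c13 || (p && a && c1b)`,
`H3 := c23 || (p && a && c2b)` the state is
`(c12 || (p && a && (c23 || c2b) && (c13 || c1b)), (p && L3) || (a && Lb), (p && H3) || (a && Hb),
Lb, Hb, L3, H3)`. -/
lemma st_modelG {e f : E} (hef : e ≠ f) (he : ends e = s(a₃, o)) (hf : ends f = s(o, b))
    (ho1 : o ≠ a₁) (ho2 : o ≠ a₂) (ho3 : o ≠ a₃) (hob : o ≠ b) (x : Config E)
    (hother : ∀ e', e' ≠ e → e' ≠ f → o ∈ ends e' → x e' = false) (p a : Bool) :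
    st ends o a₁ a₂ a₃ b (Function.update (Function.update x e p) f a) =
      (decide (Conn ends (Function.update (Function.update x e false) f false) a₁ a₂) ||
          (p && a && (decide (Conn ends (Function.update (Function.update x e false) f false) a₂ a₃) ||
              decide (Conn ends (Function.update (Function.update x e false) f false) a₂ b)) &&
            (decide (Conn ends (Function.update (Function.update x e false) f false) a₁ a₃) ||
              decide (Conn ends (Function.update (Function.update x e false) f false) a₁ b))),
        (p && (decide (Conn ends (Function.update (Function.update x e false) f false) a₁ a₃) ||
            (p && a && decide (Conn ends (Function.update (Function.update x e false) f false) a₁ b)))) ||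
          (a && (decide (Conn ends (Function.update (Function.update x e false) f false) a₁ b) ||
            (p && a && decide (Conn ends (Function.update (Function.update x e false) f false) a₁ a₃)))),
        (p && (decide (Conn ends (Function.update (Function.update x e false) f false) a₂ a₃) ||
            (p && a && decide (Conn ends (Function.update (Function.update x e false) f false) a₂ b)))) ||
          (a && (decide (Conn ends (Function.update (Function.update x e false) f false) a₂ b) ||
            (p && a && decide (Conn ends (Function.update (Function.update x e false) f false) a₂ a₃)))),
        decide (Conn ends (Function.update (Function.update x e false) f false) a₁ b) ||
          (p && a && decide (Conn ends (Function.update (Function.update x e false) f false) a₁ a₃)),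
        decide (Conn ends (Function.update (Function.update x e false) f false) a₂ b) ||
          (p && a && decide (Conn ends (Function.update (Function.update x e false) f false) a₂ a₃)),
        decide (Conn ends (Function.update (Function.update x e false) f false) a₁ a₃) ||
          (p && a && decide (Conn ends (Function.update (Function.update x e false) f false) a₁ b)),
        decide (Conn ends (Function.update (Function.update x e false) f false) a₂ a₃) ||
          (p && a && decide (Conn ends (Function.update (Function.update x e false) f false) a₂ b))) := by
  have off := fun {s t : V} (hs : s ≠ o) (ht : t ≠ o) =>
    conn_off_mid hef he hf ho3 hob x hother p a hs ht
  have mid := fun {s : V} (hs : s ≠ o) => conn_mid_iff hef he hf ho3 hob x hother p a hs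
  set x₀ := Function.update (Function.update x e false) f false with hx₀
  set x' := Function.update (Function.update x e p) f a with hx'
  have s21 : Conn ends x₀ a₂ a₁ ↔ Conn ends x₀ a₁ a₂ := ⟨conn_symm, conn_symm⟩
  have sb1 : Conn ends x₀ b a₁ ↔ Conn ends x₀ a₁ b := ⟨conn_symm, conn_symm⟩
  have sb2 : Conn ends x₀ b a₂ ↔ Conn ends x₀ a₂ b := ⟨conn_symm, conn_symm⟩
  have s31 : Conn ends x₀ a₃ a₁ ↔ Conn ends x₀ a₁ a₃ := ⟨conn_symm, conn_symm⟩
  have s32 : Conn ends x₀ a₃ a₂ ↔ Conn ends x₀ a₂ a₃ := ⟨conn_symm, conn_symm⟩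
  have hoff21 := off ho2.symm ho1.symm
  have hoff1b := off ho1.symm hob.symm
  have hoff2b := off ho2.symm hob.symm
  have hoff13 := off ho1.symm ho3.symm
  have hoff23 := off ho2.symm ho3.symm
  have hmid1 := mid ho1.symm
  have hmid2 := mid ho2.symm
  -- the four off-`o` coordinates, as propositional facts
  have eLb : Conn ends x' a₁ b ↔ Conn ends x₀ a₁ b ∨ ((p = true ∧ a = true) ∧ Conn ends x₀ a₁ a₃) := by
    rw [hoff1b]
    constructor
    · rintro (h | ⟨hm, h1 | h1, _⟩)
      · exact Or.inl h
      · exact Or.inr ⟨hm, h1⟩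
      · exact Or.inl h1
    · rintro (h | ⟨hm, h⟩)
      · exact Or.inl h
      · exact Or.inr ⟨hm, Or.inl h, Or.inr (conn_refl ends x₀ b)⟩
  have eHb : Conn ends x' a₂ b ↔ Conn ends x₀ a₂ b ∨ ((p = true ∧ a = true) ∧ Conn ends x₀ a₂ a₃) := by
    rw [hoff2b]
    constructor
    · rintro (h | ⟨hm, h1 | h1, _⟩)
      · exact Or.inl h
      · exact Or.inr ⟨hm, h1⟩
      · exact Or.inl h1
    · rintro (h | ⟨hm, h⟩)
      · exact Or.inl h
      · exact Or.inr ⟨hm, Or.inl h, Or.inr (conn_refl ends x₀ b)⟩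
  have eL3 : Conn ends x' a₁ a₃ ↔ Conn ends x₀ a₁ a₃ ∨ ((p = true ∧ a = true) ∧ Conn ends x₀ a₁ b) := by
    rw [hoff13]
    constructor
    · rintro (h | ⟨hm, h1 | h1, _⟩)
      · exact Or.inl h
      · exact Or.inl h1
      · exact Or.inr ⟨hm, h1⟩
    · rintro (h | ⟨hm, h⟩)
      · exact Or.inl h
      · exact Or.inr ⟨hm, Or.inr h, Or.inl (conn_refl ends x₀ a₃)⟩
  have eH3 : Conn ends x' a₂ a₃ ↔ Conn ends x₀ a₂ a₃ ∨ ((p = true ∧ a = true) ∧ Conn ends x₀ a₂ b) := by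
    rw [hoff23]
    constructor
    · rintro (h | ⟨hm, h1 | h1, _⟩)
      · exact Or.inl h
      · exact Or.inl h1
      · exact Or.inr ⟨hm, h1⟩
    · rintro (h | ⟨hm, h⟩)
      · exact Or.inl h
      · exact Or.inr ⟨hm, Or.inr h, Or.inl (conn_refl ends x₀ a₃)⟩
  have eQ : Conn ends x' a₂ a₁ ↔ Conn ends x₀ a₁ a₂ ∨ ((p = true ∧ a = true) ∧
      (Conn ends x₀ a₂ a₃ ∨ Conn ends x₀ a₂ b) ∧ (Conn ends x₀ a₁ a₃ ∨ Conn ends x₀ a₁ b)) := by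
    rw [hoff21, s21]
  have eLo : Conn ends x' a₁ o ↔ (p = true ∧ Conn ends x' a₁ a₃) ∨ (a = true ∧ Conn ends x' a₁ b) :=
    hmid1
  have eHo : Conn ends x' a₂ o ↔ (p = true ∧ Conn ends x' a₂ a₃) ∨ (a = true ∧ Conn ends x' a₂ b) :=
    hmid2
  simp only [st, Prod.mk.injEq]
  refine ⟨?_, ?_, ?_, ?_, ?_, ?_, ?_⟩
  · apply Bool.eq_iff_iff.mpr
    simp only [decide_eq_true_eq, Bool.or_eq_true, Bool.and_eq_true]
    rw [eQ]
    simp only [and_assoc]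
  · apply Bool.eq_iff_iff.mpr
    simp only [decide_eq_true_eq, Bool.or_eq_true, Bool.and_eq_true]
    rw [eLo, eL3, eLb]
  · apply Bool.eq_iff_iff.mpr
    simp only [decide_eq_true_eq, Bool.or_eq_true, Bool.and_eq_true]
    rw [eHo, eH3, eHb]
  · apply Bool.eq_iff_iff.mpr
    simp only [decide_eq_true_eq, Bool.or_eq_true, Bool.and_eq_true]
    rw [eLb]
  · apply Bool.eq_iff_iff.mpr
    simp only [decide_eq_true_eq, Bool.or_eq_true, Bool.and_eq_true]
    rw [eHb]
  · apply Bool.eq_iff_iff.mpr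
    simp only [decide_eq_true_eq, Bool.or_eq_true, Bool.and_eq_true]
    rw [eL3]
  · apply Bool.eq_iff_iff.mpr
    simp only [decide_eq_true_eq, Bool.or_eq_true, Bool.and_eq_true]
    rw [eH3]

end StateLemmas

end MarkedSeries

end CovForm

end Summit.Ventures.PercRepro2
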